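import Summits.ABC.ABC.Theorems.DeepRegimeABC.Negative.WithoutEps
import Literature.NumberTheory.DiophantineGeometry.AbcImpliesHall

/-!
# `DeepRegimeABC` (stmt-ABC-15121): coprimality is load-bearing on every deep cell

Negative-side support lemma for the crux `Summit.ABC.ABC.Theses.IneffectiveSubspace.DeepRegimeABC`
(abc on an `ε`-dependent deep tail `{ω₅(abc) ≥ K(ε)}`), from the crux disprover's work file
`Cruxes/DeepRegimeABC/Disproof.lean` §(a) (2026-08-16):

* `deepRegimeABC_false_without_coprime` — the crux with `Nat.Coprime a b` dropped from `IsABCTriple`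
  (positivity and `a + b = c` kept) is FALSE, already at `ε = 1`: for every `K`, `C` the triple
  `(d, d, 2d)` with `d = N^m`, `N = 2·p₀⋯p_{K−1}`, `m ≥ 5` lies in the cell `{ω₅ ≥ K}`, has
  `rad(d·d·2d) ≤ 2N`, while `c = 2N^m` is unbounded in `m`.  So any proof of the crux must use
  coprimality on the deep tail too (depth does not substitute for it), exactly as for abc itself.
-/

-- `Summit.<Summit>.<Problem>` is the mandated summit-side namespace (CONVENTIONS §2); for the
-- single-conjunct summit `ABC` the two coincide, so the duplicate `ABC.ABC` is deliberate.
set_option linter.dupNamespace false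

namespace Summit.ABC.ABC.Theorems.DeepRegimeABC.Negative

open Literature.NumberTheory.DiophantineGeometry UniqueFactorizationMonoid

/-- **Coprimality is load-bearing on every deep cell.** The crux `DeepRegimeABC` with coprimality
dropped fails: `(d, d, 2d)`, `d = N^m`, `N = 2·p₀⋯p_{K−1}`, `m = ⌈4CN²⌉₊ + 5`, has `ω₅ ≥ K`,
`rad ≤ 2N` and `C·rad² ≤ 4CN² < N^m < c`. [folklore] -/
theorem deepRegimeABC_false_without_coprime :
    ¬ ∀ ε : ℝ, 0 < ε → ∃ K : ℕ, ∃ C : ℝ, 0 < C ∧ ∀ a b c : ℕ, 0 < a → 0 < b → a + b = c →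
        K ≤ ((a * b * c).primeFactors.filter (fun p => 5 ≤ (a * b * c).factorization p)).card →
        (c : ℝ) < C * ((rad a b c : ℕ) : ℝ) ^ (1 + ε) := by
  intro h
  obtain ⟨K, C, hC, hKC⟩ := h 1 one_pos
  obtain ⟨h2N, hdvdN⟩ := deepModulus_spec K
  set N : ℕ := 2 * ∏ i ∈ Finset.range K, Nat.nth Nat.Prime i with hN
  -- exponent: m = t + 5 with 2^t > t ≥ 4·C·N²
  set t : ℕ := ⌈4 * C * (N : ℝ) ^ 2⌉₊ with ht
  set m : ℕ := t + 5 with hm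
  set d : ℕ := N ^ m with hd
  have hNpos : 0 < N := by omega
  have hdpos : 0 < d := pow_pos hNpos m
  have hlt := hKC d d (2 * d) hdpos hdpos (by ring) ?depth
  case depth =>
    have hne : d * d * (2 * d) ≠ 0 := by positivity
    refine le_card_deep_of_dvd hne hdvdN ?_
    calc N ^ 5 ∣ N ^ m := pow_dvd_pow N (by omega)
      _ ∣ d * d * (2 * d) := Dvd.intro (d * (2 * d)) (by rw [hd]; ring)
  -- rad(d·d·2d) ≤ 2N, since d·d·2d = 2·N^(3m) ∣ (2N)^(3m)
  have hrad : rad d d (2 * d) ≤ 2 * N := by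
    rw [rad_def]
    refine radical_le_of_dvd_pow (n := 3 * m) (by omega) ?_
    have h3m : 3 * m ≠ 0 := by omega
    calc d * d * (2 * d) = 2 * N ^ (3 * m) := by rw [hd]; ring
      _ ∣ 2 ^ (3 * m) * N ^ (3 * m) := mul_dvd_mul (dvd_pow_self 2 h3m) dvd_rfl
      _ = (2 * N) ^ (3 * m) := (mul_pow 2 N (3 * m)).symm
  -- sizes in ℝ
  have hNR : (2 : ℝ) ≤ N := by exact_mod_cast h2N
  have hradR : ((rad d d (2 * d) : ℕ) : ℝ) ≤ 2 * N := by exact_mod_cast hrad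
  have htR : 4 * C * (N : ℝ) ^ 2 ≤ t := Nat.le_ceil _
  have ht2 : (t : ℝ) < (2 : ℝ) ^ t := by exact_mod_cast Nat.lt_two_pow_self
  have h2N : (2 : ℝ) ^ t ≤ (N : ℝ) ^ t := pow_le_pow_left₀ (by norm_num) hNR t
  have hNm : (N : ℝ) ^ t ≤ (N : ℝ) ^ m := pow_le_pow_right₀ (by linarith) (by omega)
  have hc : (((2 * d : ℕ)) : ℝ) = 2 * (N : ℝ) ^ m := by rw [hd]; push_cast; ring
  have key : C * ((rad d d (2 * d) : ℕ) : ℝ) ^ (1 + (1 : ℝ)) ≤ ((2 * d : ℕ) : ℝ) := by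
    have h11 : (1 : ℝ) + 1 = ((2 : ℕ) : ℝ) := by norm_num
    rw [h11, Real.rpow_natCast, hc]
    have hr0 : (0 : ℝ) ≤ ((rad d d (2 * d) : ℕ) : ℝ) := Nat.cast_nonneg _
    calc C * ((rad d d (2 * d) : ℕ) : ℝ) ^ 2 ≤ C * (2 * N) ^ 2 := by gcongr
      _ = 4 * C * (N : ℝ) ^ 2 := by ring
      _ ≤ t := htR
      _ ≤ (N : ℝ) ^ m := by linarith
      _ ≤ 2 * (N : ℝ) ^ m := by linarith [pow_nonneg (by linarith : (0 : ℝ) ≤ N) m]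
  exact absurd hlt (not_lt.mpr key)

end Summit.ABC.ABC.Theorems.DeepRegimeABC.Negative
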